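import Summits.Ventures.PercRepro.S1SevenFiveThreeFour

/-!
# PercRepro — EVERY `1`-SEPARABLE `(7, 5)` CORE SATISFIES THE `(7, 4)` BODY (p2, gen 28; SUBCLAIM-S1 §6.10
(xvii)(m))

The `(7, 5)` twin of `S1OneSeparableNineFive` / `S1EightFiveSeparators`. A finite coloop-free matroid of rank `7`
on `12` points with all pairs of rank `2` and a proper separator `A`: both parts are coloop-free hence dependent
and of rank `≥ 2`, the nullities add to `5` — nullity `1` is a circuit of `M` (`rls_seven_four_of_circuit_separator`,
every circuit summand), otherwise the corank-`2` part has rank `k ∈ {2, …, 5}` and the consumers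
`S1SevenFive{RankTwoParts, FourThree, ThreeFour}` apply through the bridge `eq_disjointSum_restrict_of_separator`.
Nothing is claimed about any cell.

* `rls_seven_four_of_corank_two_separator_{two, three, four, five}` — the four shapes in RLS form;
* **`rls_seven_four_of_separator`** — the capstone at `(7, 5)`.
Axioms: standard.
-/

open scoped Matroid

namespace PercRepro

namespace S1

open Set

variable {α : Type}

section Shapes

variable (M : Matroid α) [M.Finite] {A : Set α} (hA : A ⊆ M.E) (hsep : M.eRk A + M.eRk (M.E \ A) = M.eRank)
  (hpairs : ∀ e ∈ M.E, ∀ f ∈ M.E, e ≠ f → M.eRk {e, f} = 2) (hM : M.eRank = ((7 : ℕ) : ℕ∞))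
  (hE : M.E.ncard = 12)

include hA hsep hpairs hM hE

/-- `(7, 4)` with a `4`-point line as a separator — the `(5, 2)` shape. -/
theorem rls_seven_four_of_corank_two_separator_two (hA4 : A.ncard = 4) (hrA : M.eRk A = ((2 : ℕ) : ℕ∞)) :
    ThmN.RLS M 7 4 := by
  have hB : M.E \ A ⊆ M.E := sdiff_subset
  have hsep' : M.eRk (M.E \ A) + M.eRk (M.E \ (M.E \ A)) = M.eRank := by
    rw [sdiff_sdiff_cancel_left hA, add_comm]; exact hsep
  have heq := eq_disjointSum_restrict_of_separator M hB hsep'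
  haveI hBfin : (M ↾ (M.E \ A)).Finite := Matroid.restrict_finite (M.ground_finite.subset hB)
  haveI hAfin : (M ↾ A).Finite := Matroid.restrict_finite (M.ground_finite.subset hA)
  have hrB := restrict_compl_eRank_of_separator M hsep (k := 2) (l := 5) hrA hM
  have hBE : (M ↾ (M.E \ A)).E.ncard = 8 := by
    rw [Matroid.restrict_ground_eq, ncard_sdiff' hA M.ground_finite, hE, hA4]
  have hrA' : (M ↾ A).eRank = ((2 : ℕ) : ℕ∞) := by rw [Matroid.eRank_restrict]; exact hrA
  have hAE' : (M ↾ A).E.ncard = 4 := by rw [Matroid.restrict_ground_eq]; exact hA4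
  unfold ThmN.RLS
  rw [heq]
  have hAA : M.E \ (M.E \ A) = A := sdiff_sdiff_cancel_left hA
  have key := c025_seven_four_disjointSum_five_two (M ↾ (M.E \ A)) (M ↾ A)
    (by simp only [Matroid.restrict_ground_eq]; exact disjoint_sdiff_left) hrB hBE hrA' hAE'
    (restrict_pairs_of_pairs M hpairs hA)
  convert key using 3 <;> simp only [hAA]

/-- `(7, 4)` with a rank-`3` separator of `5` points — the `(4, 3)` shape. -/
theorem rls_seven_four_of_corank_two_separator_three (hA5 : A.ncard = 5) (hrA : M.eRk A = ((3 : ℕ) : ℕ∞))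
    (hcol : M.coloops = ∅) : ThmN.RLS M 7 4 := by
  have hB : M.E \ A ⊆ M.E := sdiff_subset
  have hsep' : M.eRk (M.E \ A) + M.eRk (M.E \ (M.E \ A)) = M.eRank := by
    rw [sdiff_sdiff_cancel_left hA, add_comm]; exact hsep
  have heq := eq_disjointSum_restrict_of_separator M hB hsep'
  haveI hBfin : (M ↾ (M.E \ A)).Finite := Matroid.restrict_finite (M.ground_finite.subset hB)
  haveI hAfin : (M ↾ A).Finite := Matroid.restrict_finite (M.ground_finite.subset hA)
  have hrB := restrict_compl_eRank_of_separator M hsep (k := 3) (l := 4) hrA hM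
  have hBE : (M ↾ (M.E \ A)).E.ncard = 7 := by
    rw [Matroid.restrict_ground_eq, ncard_sdiff' hA M.ground_finite, hE, hA5]
  have hrA' : (M ↾ A).eRank = ((3 : ℕ) : ℕ∞) := by rw [Matroid.eRank_restrict]; exact hrA
  have hAE' : (M ↾ A).E.ncard = 5 := by rw [Matroid.restrict_ground_eq]; exact hA5
  have hcolB : (M ↾ (M.E \ A)).coloops = ∅ := restrict_coloops_eq_empty_of_separator M hB hsep' hcol
  have hcolA : (M ↾ A).coloops = ∅ := restrict_coloops_eq_empty_of_separator M hA hsep hcol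
  unfold ThmN.RLS
  rw [heq]
  have hAA : M.E \ (M.E \ A) = A := sdiff_sdiff_cancel_left hA
  have key := c025_seven_four_disjointSum_four_three (M ↾ (M.E \ A)) (M ↾ A)
    (by simp only [Matroid.restrict_ground_eq]; exact disjoint_sdiff_left) hrB hBE hcolB
    (restrict_pairs_of_pairs M hpairs hB) hrA' hAE' hcolA (restrict_pairs_of_pairs M hpairs hA)
  convert key using 3 <;> simp only [hAA]

/-- `(7, 4)` with a rank-`4` separator of `6` points — the `(3, 4)` shape. -/
theorem rls_seven_four_of_corank_two_separator_four (hA6 : A.ncard = 6) (hrA : M.eRk A = ((4 : ℕ) : ℕ∞))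
    (hcol : M.coloops = ∅) : ThmN.RLS M 7 4 := by
  have hB : M.E \ A ⊆ M.E := sdiff_subset
  have hsep' : M.eRk (M.E \ A) + M.eRk (M.E \ (M.E \ A)) = M.eRank := by
    rw [sdiff_sdiff_cancel_left hA, add_comm]; exact hsep
  have heq := eq_disjointSum_restrict_of_separator M hB hsep'
  haveI hBfin : (M ↾ (M.E \ A)).Finite := Matroid.restrict_finite (M.ground_finite.subset hB)
  haveI hAfin : (M ↾ A).Finite := Matroid.restrict_finite (M.ground_finite.subset hA)
  have hrB := restrict_compl_eRank_of_separator M hsep (k := 4) (l := 3) hrA hM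
  have hBE : (M ↾ (M.E \ A)).E.ncard = 6 := by
    rw [Matroid.restrict_ground_eq, ncard_sdiff' hA M.ground_finite, hE, hA6]
  have hrA' : (M ↾ A).eRank = ((4 : ℕ) : ℕ∞) := by rw [Matroid.eRank_restrict]; exact hrA
  have hAE' : (M ↾ A).E.ncard = 6 := by rw [Matroid.restrict_ground_eq]; exact hA6
  have hcolB : (M ↾ (M.E \ A)).coloops = ∅ := restrict_coloops_eq_empty_of_separator M hB hsep' hcol
  have hcolA : (M ↾ A).coloops = ∅ := restrict_coloops_eq_empty_of_separator M hA hsep hcol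
  unfold ThmN.RLS
  rw [heq]
  have hAA : M.E \ (M.E \ A) = A := sdiff_sdiff_cancel_left hA
  have key := c025_seven_four_disjointSum_three_four (M ↾ (M.E \ A)) (M ↾ A)
    (by simp only [Matroid.restrict_ground_eq]; exact disjoint_sdiff_left) hrB hBE hcolB
    (restrict_pairs_of_pairs M hpairs hB) hrA' hAE' hcolA (restrict_pairs_of_pairs M hpairs hA)
  convert key using 3 <;> simp only [hAA]

/-- `(7, 4)` with a rank-`5` separator of `7` points — the `(2, 5)` shape (the complement is `U_{2,5}`). -/
theorem rls_seven_four_of_corank_two_separator_five (hA7 : A.ncard = 7) (hrA : M.eRk A = ((5 : ℕ) : ℕ∞)) :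
    ThmN.RLS M 7 4 := by
  have hB : M.E \ A ⊆ M.E := sdiff_subset
  have hsep' : M.eRk (M.E \ A) + M.eRk (M.E \ (M.E \ A)) = M.eRank := by
    rw [sdiff_sdiff_cancel_left hA, add_comm]; exact hsep
  have heq := eq_disjointSum_restrict_of_separator M hB hsep'
  haveI hBfin : (M ↾ (M.E \ A)).Finite := Matroid.restrict_finite (M.ground_finite.subset hB)
  haveI hAfin : (M ↾ A).Finite := Matroid.restrict_finite (M.ground_finite.subset hA)
  have hrB := restrict_compl_eRank_of_separator M hsep (k := 5) (l := 2) hrA hM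
  have hBE : (M ↾ (M.E \ A)).E.ncard = 5 := by
    rw [Matroid.restrict_ground_eq, ncard_sdiff' hA M.ground_finite, hE, hA7]
  have hrA' : (M ↾ A).eRank = ((5 : ℕ) : ℕ∞) := by rw [Matroid.eRank_restrict]; exact hrA
  have hAE' : (M ↾ A).E.ncard = 7 := by rw [Matroid.restrict_ground_eq]; exact hA7
  unfold ThmN.RLS
  rw [heq]
  have hAA : M.E \ (M.E \ A) = A := sdiff_sdiff_cancel_left hA
  have key := c025_seven_four_disjointSum_two_five (M ↾ (M.E \ A)) (M ↾ A)
    (by simp only [Matroid.restrict_ground_eq]; exact disjoint_sdiff_left) hrB hBE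
    (restrict_pairs_of_pairs M hpairs hB) hrA' hAE'
  convert key using 3 <;> simp only [hAA]

end Shapes

/-- **THE CAPSTONE AT `(7, 5)`**: a finite coloop-free matroid of rank `7` on `12` points with all pairs of rank
`2` that has a proper separator satisfies `ThmN.RLS M 7 4`. -/
theorem rls_seven_four_of_separator (M : Matroid α) [M.Finite] {A : Set α} (hA : A ⊆ M.E) (hne : A.Nonempty)
    (hne' : (M.E \ A).Nonempty) (hsep : M.eRk A + M.eRk (M.E \ A) = M.eRank)
    (hpairs : ∀ e ∈ M.E, ∀ f ∈ M.E, e ≠ f → M.eRk {e, f} = 2) (hM : M.eRank = ((7 : ℕ) : ℕ∞))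
    (hE : M.E.ncard = 12) (hcol : M.coloops = ∅) : ThmN.RLS M 7 4 := by
  have hB : M.E \ A ⊆ M.E := sdiff_subset
  have hAA : M.E \ (M.E \ A) = A := sdiff_sdiff_cancel_left hA
  have hsep' : M.eRk (M.E \ A) + M.eRk (M.E \ (M.E \ A)) = M.eRank := by
    rw [hAA, add_comm]; exact hsep
  have hne'' : (M.E \ (M.E \ A)).Nonempty := by rw [hAA]; exact hne
  have hfinA : M.eRk A ≠ ⊤ := ((M.eRk_le_encard _).trans_lt (M.ground_finite.subset hA).encard_lt_top).ne
  have hfinB : M.eRk (M.E \ A) ≠ ⊤ :=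
    ((M.eRk_le_encard _).trans_lt (M.ground_finite.subset hB).encard_lt_top).ne
  obtain ⟨k, hk⟩ := ENat.ne_top_iff_exists.mp hfinA
  obtain ⟨l, hl⟩ := ENat.ne_top_iff_exists.mp hfinB
  have hkA : M.eRk A = (k : ℕ∞) := hk.symm
  have hlB : M.eRk (M.E \ A) = (l : ℕ∞) := hl.symm
  have hkl : k + l = 7 := by
    have h := hsep
    rw [hkA, hlB, hM] at h
    exact_mod_cast h
  have hsize : A.ncard + (M.E \ A).ncard = 12 := by
    rw [ncard_sdiff' hA M.ground_finite, hE]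
    have := ncard_le_ncard hA M.ground_finite
    rw [hE] at this
    omega
  have hdepA := eRk_add_one_le_ncard_of_separator M hA hsep hcol hne hkA
  have hdepB := eRk_add_one_le_ncard_of_separator M hB hsep' hcol hne' hlB
  have hk2 := two_le_of_separator_part M hA hpairs hne' hkA hdepA
  have hl2 := two_le_of_separator_part M hB hpairs hne'' hlB hdepB
  -- the two circuit cases
  rcases Nat.lt_or_ge A.ncard (k + 2) with hcA | hcA
  · have hA1 : A.ncard = k + 1 := by omega
    have hC := isCircuit_of_separator_of_ncard_eq M hA hsep hcol hkA hA1
    have hsepC : M.eRk (M.E \ A) + M.eRk A = M.eRank := by rw [add_comm]; exact hsep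
    exact rls_seven_four_of_circuit_separator M hC hsepC (by omega) hM
  rcases Nat.lt_or_ge (M.E \ A).ncard (l + 2) with hcB | hcB
  · have hB1 : (M.E \ A).ncard = l + 1 := by omega
    have hC := isCircuit_of_separator_of_ncard_eq M hB hsep' hcol hlB hB1
    have hsepC : M.eRk (M.E \ (M.E \ A)) + M.eRk (M.E \ A) = M.eRank := by rw [add_comm]; exact hsep'
    exact rls_seven_four_of_circuit_separator M hC hsepC (by omega) hM
  -- the split cases
  have hk5 : k ≤ 5 := by omega
  have hnull : A.ncard = k + 2 ∨ A.ncard = k + 3 := by omega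
  interval_cases k
  · rcases hnull with h | h
    · exact rls_seven_four_of_corank_two_separator_two M hA hsep hpairs hM hE h hkA
    · have hlB' : M.eRk (M.E \ A) = ((5 : ℕ) : ℕ∞) := by rw [hlB]; congr 1; omega
      exact rls_seven_four_of_corank_two_separator_five M hB hsep' hpairs hM hE (by omega) hlB'
  · rcases hnull with h | h
    · exact rls_seven_four_of_corank_two_separator_three M hA hsep hpairs hM hE h hkA hcol
    · have hlB' : M.eRk (M.E \ A) = ((4 : ℕ) : ℕ∞) := by rw [hlB]; congr 1; omega
      exact rls_seven_four_of_corank_two_separator_four M hB hsep' hpairs hM hE (by omega) hlB' hcol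
  · rcases hnull with h | h
    · exact rls_seven_four_of_corank_two_separator_four M hA hsep hpairs hM hE h hkA hcol
    · have hlB' : M.eRk (M.E \ A) = ((3 : ℕ) : ℕ∞) := by rw [hlB]; congr 1; omega
      exact rls_seven_four_of_corank_two_separator_three M hB hsep' hpairs hM hE (by omega) hlB' hcol
  · rcases hnull with h | h
    · exact rls_seven_four_of_corank_two_separator_five M hA hsep hpairs hM hE h hkA
    · have hlB' : M.eRk (M.E \ A) = ((2 : ℕ) : ℕ∞) := by rw [hlB]; congr 1; omega
      exact rls_seven_four_of_corank_two_separator_two M hB hsep' hpairs hM hE (by omega) hlB'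

end S1

end PercRepro
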